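import Mathlib.Order.Filter.AtTopBot.Basic
import Mathlib.Topology.Order.Basic
import Mathlib.Analysis.SpecialFunctions.Pow.Real
import Mathlib.Analysis.Calculus.IteratedDeriv.Defs
import Mathlib.Analysis.Calculus.ContDiff.Basic
import Literature.Analysis.FluidPDE.PassiveScalar
import Literature.Analysis.FunctionSpaces.TorusCalculus
import HarnessLib

/-!
# The alternating-shear building block of the Onsager-critical forced Navier–Stokes solutions
  (Bruè–Colombo–Crippa–De Lellis–Sorella 2024, §3: parameters (3.1)–(3.4) and Proposition 3.1)

Topic `Analysis/FluidPDE`; §3 companion of `AnomalousDissipationOnsagerCritical.lean` (Theorem A),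
`AnomalousDissipationLackOfSelection.lean` (Theorems B, C) and `ObukhovCorrsinAnomalousDissipation.lean`
(Colombo–Crippa–Sorella 2023, Theorems A–C, from whose §4 the block is "taken"). Vocabulary reused, never
redeclared: `Torus.IsWeakScalarTransportOn`, `Torus.eScalarDissipation` (`PassiveScalar.lean`),
`FunctionSpaces.Torus.IsSmoothSpaceTimeOn / IsDivFree / IsSmooth / HasZeroMean / gradient / proj`.

E. Bruè, M. Colombo, G. Crippa, C. De Lellis, M. Sorella, *Onsager critical solutions of the forced
Navier–Stokes equations*, Commun. Pure Appl. Anal. 23 (2024) no. 10, 1350–1366 = arXiv:2212.08413v1 (the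
only arXiv version; all locators are those of the arXiv v1 PDF, page-confirmed 2026-08-26 — §3 "Construction
and main properties of the 2d velocity field" pp. 5–6: §3.1 (3.1a)–(3.1c), (3.2), (3.3), (3.4); §3.2
`supp_T`, the intervals `I_q = [1-T_q, 1-T_{q+1}]`, `J_q = [1+T_{q+1}, 1+T_q]`, `q ∈ ℕ ∪ {-1}`, `T_{-1} = 1`;
**Proposition 3.1** p. 6 with (3.5)–(3.10) and its proof: "The velocity field with all the above properties
is obtained from the one constructed in [CCS22, Section 4] choosing `p = p° = 1/3` [sic: `1/p = 1/p° = 1/3`].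
Properties (1) and (2) are a direct consequence of the construction in [CCS22, Section 4]. Property (3) is
given in [CCS22, Remark 4.2]. Property (4) has been proved in [CCS22, Section 8]. Property (5) has been proved
in [CCS22, Section 7] and it is stated in [CCS22, Theorem A]."; §4 p. 7: (4.1) `u_q = u·1_{K_q}`,
`K_q = [0,1-T_q] ∪ [1+T_q,2]`, (4.2) `v_in = (0, ϑ_in)`, Lemma 4.1, (4.3)–(4.6), Lemma 4.2, Remark 4.3).

## Why this file

Theorem A of the source (`BCCDS2024_onsagerCritical`) is assembled in its §§4–5 from ONE planar object: the
alternating shear flow `u` of Colombo–Crippa–Sorella with the `p = p° = 3` parameter bookkeeping, its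
super-exponentially shrinking time slots `I_q`, `J_q` accumulating at the singular time `t = 1`, the
explicit growth (3.7) of its derivatives, the `a_{q+1}^{-1-3ε(1+δ)}` gradient bound of the advected scalars,
and anomalous dissipation `> 1/2` along the explicit diffusivities `ν̃_q = a_q^{2 - γ/(1+δ) + 4ε}` (3.9).
Proposition 3.1 is that object's printed specification; it is the quantitative "cascade of shear pulses"
against which the summit routes on `T³ × [0,1]` (e.g. `Summits/AnomalousDissipation/…/Theses/SawtoothPulseCascade`,
cruxes K1loc/K2″/K3loc) measure their own constructions, and the hypothesis from which a Lean derivation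
of Theorem A along §§4–5 would start. The `2½`-dimensional packaging of §4 (Lemma 4.1: for the shear flow
`u_q`, `(u_q·∇)u_q = 0`, so `v_ν = (u_q, ϑ̃_ν)`, `p_ν = 0`, `F_ν = (∂ₜu_q - νΔu_q, 0)` is the smooth
Navier–Stokes solution from `v_in = (0, ϑ_in)`) is NOT vendored as a fact: it is the packaging theorem
`Literature.Analysis.FluidPDE.Torus.isClassicalNSSolutionOn_twoHalf` (`TwoHalfNavierStokes.lean`) applied
to `V = u_q`, `R = ϑ̃_ν`, `φ = 0` (its force `twoHalfForce` has planar part `∂ₜu_q + (u_q·∇)u_q - νΔu_q`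
and vanishing vertical part for a scalar solving the advection–diffusion equation).

## Contents

* `BCCDS2024.gammaOf β ε δ` ((3.2)), `BCCDS2024.aSeq a₀ δ q = a₀^{(1+δ)^q}` ((3.4): `a_{q+1} = a_q^{1+δ}`),
  `BCCDS2024.lambdaSeq` (`λ_q = 1/(2a_q)`), `BCCDS2024.viscSeq` ((3.9) `ν̃_q`), `BCCDS2024.ParamsAdmissible`
  (§3.1: (3.1a)–(3.1c), `γ < 1` of (3.2), (3.3)) — **definitions**, with the proved API `aSeq_zero`,
  `aSeq_succ`, `aSeq_pos`, `ParamsAdmissible.gammaOf_lt_one`, `ParamsAdmissible.gammaOf_pos`.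
* `BCCDS2024.temporalSupport f` (§3.2 `supp_T`), `BCCDS2024.slotI T q`, `BCCDS2024.slotJ T q` (the
  intervals `I_q`, `J_q`, `q ∈ ℕ`; `I_{-1} = [0, 1-T_0]`, `J_{-1} = [1+T_0, 2]` are spelled out),
  `BCCDS2024.mixedDerivSup S k ℓ u` (`‖∂ₜ^ℓ ∇^k u‖_{L^∞(S × T²)}` through the space–time lift) —
  **definitions** (plumbing for (3.5)–(3.7)).
* `BCCDS2024_prop31` — **named fact**: Proposition 3.1 as printed.

## Rendering (faithfulness notes)

* Parameters are real numbers subject to `ParamsAdmissible`; `q ∈ mℕ` is `m ∣ q` (`0 < m`).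
* (1) "coincides either with an horizontal shear flow, or with a vertical one": at each `t ∈ (0,2)`,
  `u(t,x) = (W(x₂), 0)` for all `x` or `u(t,x) = (0, W(x₁))` for all `x`, for some `W : T → ℝ` (the reading
  of §2 p. 5: "for every `t ∈ (0,1)` we have either `u(t,x₁,x₂) = (W(t,x₂),0)` or `u(t,x₁,x₂) = (0,W(t,x₁))`").
* (2) `|supp_T(u) ∩ (I_q ∪ J_q)|` is Lebesgue measure (`volume.real`); "`u(t,·) ≡ 0` for any `t` in a
  neighborhood of `1 - T_q` and `1 + T_q`" is `∀ᶠ t in 𝓝 (1 ∓ T_q), u t = 0`.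
* (3) `‖∂ₜ^ℓ ∇^k u‖_{L^∞((I_q ∪ J_q) × T²)}` is the supremum over `t ∈ I_q ∪ J_q`, `y ∈ ℝ²` of the operator
  norm of the `k`-th Fréchet derivative in `y` of `y ↦ ∂ₜ^ℓ u(t, π y)` (`iteratedDeriv` in time of the
  space–time lift, then `iteratedFDeriv` in space); any of the equivalent finite-dimensional tensor norms
  changes only the constant `C = C(k, ℓ)`, which is existential.
* (4) "unique bounded solution" for `ν > 0`, and for `ν = 0` "a unique bounded solution with the symmetry
  `ϑ₀(t,x) = ϑ₀(2-t,x)` for any `t ∈ (1,2)`": a bounded weak solution on `T² × [0,2)`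
  (`Torus.IsWeakScalarTransportOn 2 ν u ϑ_in`) exists (symmetric for `ν = 0`), and any two BOUNDED weak
  solutions — for `ν = 0`: any two bounded weak solutions both having the reflection symmetry — agree a.e.
  (uniqueness in the printed class: across the singular time `t = 1` bounded transport solutions without
  the symmetry are NOT unique, Theorem B ibid. / Colombo–Crippa–Sorella Theorem B; corrected 2026-08-26, the
  first landing of this file had quantified the `ν = 0` uniqueness over all bounded weak solutions); the
  symmetry and the
  gradient bound `sup_{ν∈[0,1]} ‖∇ϑ_ν‖_{L^∞(I_q × T²)} ≤ ‖∇ϑ_in‖_{L^∞} a_{q+1}^{-1-3ε(1+δ)}` — which cannot be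
  asked of every a.e. representative — are properties of the bounded representative asserted to exist
  (smooth slices on the `I_q`, classical gradient `Torus.gradient`, `‖∇ϑ_in‖_{L^∞} = sup_x ‖∇ϑ_in(x)‖`).
* (5) `2ν̃_q ∫₀^{1-T_q+t̄_q} ∫_{T²} |∇ϑ_{ν̃_q}|² > 1/2` with the spectral `Torus.eScalarDissipation` (insensitive
  to null modifications), for every bounded weak solution with diffusivity `ν̃_q` (unique by (4)).
* `u ∈ C^∞_loc(((0,2) ∖ {1}) × T²; ℝ²)` is `IsSmoothSpaceTimeOn (Ioo 0 2 ∖ {1}) u`; "divergence-free" is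
  classical at every `t ∈ (0,2) ∖ {1}`. `T²` only (`UnitAddTorus (Fin 2)`, `EuclideanSpace ℝ (Fin 2)`).
  No instances, no notation; nothing here is proved beyond the parameter API (the content is CCS 2023 §§4, 7, 8).
* NOT vendored: Lemma 4.1 / Lemma 4.2 / Remark 4.3 (instances of `Torus.isClassicalNSSolutionOn_twoHalf`,
  see above), §5's estimates (5.1)–(5.4) (the derivation of Theorems A, B from Proposition 3.1).

## References

* E. Bruè, M. Colombo, G. Crippa, C. De Lellis, M. Sorella, Commun. Pure Appl. Anal. 23 (2024) no. 10,
  arXiv:2212.08413v1: §3 pp. 5–6 ((3.1)–(3.4), `supp_T`, `I_q`, `J_q`, Prop. 3.1 with (3.5)–(3.10));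
  §4 p. 7 (Lemma 4.1, (4.1)–(4.6)). [`BCCDS2024`]
* M. Colombo, G. Crippa, M. Sorella, Ann. PDE 9 (2023) Paper 21: §4.1 (4.1)–(4.6) pp. 20–21, §4.2–4.3
  pp. 22–24, Rem. 4.2 pp. 26–27, §7 pp. 38–42, §8 pp. 43–46 (the proofs behind Prop. 3.1).
  [`ColomboCrippaSorella2023`]
-/

open MeasureTheory Set Filter Topology
open scoped NNReal ENNReal

noncomputable section

namespace Literature.Analysis.FluidPDE

namespace BCCDS2024

/-! ## §3.1 The parameters -/

/-- The time-scaling exponent `γ = 3β(1+3ε(1+δ))(1+δ)/(1-δ) + δ/8` of Bruè–Colombo–Crippa–De Lellis–Sorella,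
(3.2) p. 5 (the `p° = 3` case of Colombo–Crippa–Sorella (4.4)). [cite: BCCDS2024, (3.2) p. 5] -/
def gammaOf (β ε δ : ℝ) : ℝ :=
  3 * β * (1 + 3 * ε * (1 + δ)) * (1 + δ) / (1 - δ) + δ / 8

/-- The super-exponential length scales `a_q`, (3.4) p. 6: `a_{q+1} = a_q^{1+δ}`, i.e. `a_q = a₀^{(1+δ)^q}`
(closed form, so that the recursion is the proved `aSeq_succ`). [cite: BCCDS2024, (3.4) p. 6] -/
def aSeq (a₀ δ : ℝ) (q : ℕ) : ℝ :=
  a₀ ^ ((1 + δ) ^ q)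

/-- The frequencies `λ_q = 1/(2a_q)`, (3.4) p. 6. [cite: BCCDS2024, (3.4) p. 6] -/
def lambdaSeq (a₀ δ : ℝ) (q : ℕ) : ℝ :=
  1 / (2 * aSeq a₀ δ q)

/-- The dissipating diffusivities `ν̃_q = a_q^{2 - γ/(1+δ) + 4ε}`, (3.9) p. 6 (Colombo–Crippa–Sorella (4.6)).
[cite: BCCDS2024, (3.9) p. 6] -/
def viscSeq (a₀ δ γ ε : ℝ) (q : ℕ) : ℝ :=
  aSeq a₀ δ q ^ (2 - γ / (1 + δ) + 4 * ε)

/-- **Admissible parameters** (§3.1 pp. 5–6): `α ∈ (0,1)`, `β ∈ [0,1/3)` with `α + 2β < 1`;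
`ε, δ ∈ (0,1/4)` so small that (3.1a) `1 - 2β(1+3ε(1+δ))(1+δ)/(1-δ) - α(1+εδ)(1+δ) - δ/8 > 0`,
(3.1b) `3β(1+3ε(1+δ))(1+δ)/(1-δ) + δ/8 < 1` (i.e. `γ < 1`, (3.2)) and (3.1c) `ε ≤ δ³/50`; `a₀ ∈ (0,1)` with
(3.3) `a₀^{εδ²} + a₀^{εδ/8} ≤ 1/20`. [cite: BCCDS2024, §3.1 (3.1)–(3.3) pp. 5–6] -/
structure ParamsAdmissible (α β ε δ a₀ : ℝ) : Prop where
  /-- `α ∈ (0,1)`. -/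
  hα : 0 < α ∧ α < 1
  /-- `β ∈ [0,1/3)`. -/
  hβ : 0 ≤ β ∧ β < 1 / 3
  /-- The supercritical Obukhov–Corrsin condition `α + 2β < 1`. -/
  hOC : α + 2 * β < 1
  /-- `ε ∈ (0,1/4)`. -/
  hε : 0 < ε ∧ ε < 1 / 4
  /-- `δ ∈ (0,1/4)`. -/
  hδ : 0 < δ ∧ δ < 1 / 4
  /-- (3.1a). -/
  h31a : 0 < 1 - 2 * β * (1 + 3 * ε * (1 + δ)) * (1 + δ) / (1 - δ) - α * (1 + ε * δ) * (1 + δ) - δ / 8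
  /-- (3.1b), i.e. `γ < 1`. -/
  h31b : 3 * β * (1 + 3 * ε * (1 + δ)) * (1 + δ) / (1 - δ) + δ / 8 < 1
  /-- (3.1c). -/
  h31c : ε ≤ δ ^ 3 / 50
  /-- `a₀ ∈ (0,1)`. -/
  ha₀ : 0 < a₀ ∧ a₀ < 1
  /-- (3.3). -/
  h33 : a₀ ^ (ε * δ ^ 2) + a₀ ^ (ε * δ / 8) ≤ 1 / 20

/-- `a_0 = a₀`. [cite: BCCDS2024, (3.4) p. 6] -/
theorem aSeq_zero (a₀ δ : ℝ) : aSeq a₀ δ 0 = a₀ := by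
  simp [aSeq]

/-- The printed recursion (3.4): `a_{q+1} = a_q^{1+δ}` (for `a₀ ≥ 0`). [cite: BCCDS2024, (3.4) p. 6] -/
theorem aSeq_succ {a₀ : ℝ} (ha₀ : 0 ≤ a₀) (δ : ℝ) (q : ℕ) :
    aSeq a₀ δ (q + 1) = aSeq a₀ δ q ^ (1 + δ) := by
  unfold aSeq
  rw [pow_succ, Real.rpow_mul ha₀]

/-- `a_q > 0` for `a₀ > 0`. [cite: BCCDS2024, (3.4) p. 6] -/
theorem aSeq_pos {a₀ : ℝ} (ha₀ : 0 < a₀) (δ : ℝ) (q : ℕ) : 0 < aSeq a₀ δ q :=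
  Real.rpow_pos_of_pos ha₀ _

/-- `a_q < 1` for `a₀ ∈ (0,1)` and `δ > -1`. [cite: BCCDS2024, (3.4) p. 6] -/
theorem aSeq_lt_one {a₀ δ : ℝ} (ha₀ : 0 < a₀) (ha₁ : a₀ < 1) (hδ : -1 < δ) (q : ℕ) : aSeq a₀ δ q < 1 :=
  Real.rpow_lt_one ha₀.le ha₁ (pow_pos (by linarith) q)

/-- For admissible parameters `γ < 1` ((3.2)). [cite: BCCDS2024, (3.2) p. 5] -/
theorem ParamsAdmissible.gammaOf_lt_one {α β ε δ a₀ : ℝ} (h : ParamsAdmissible α β ε δ a₀) :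
    gammaOf β ε δ < 1 :=
  h.h31b

/-- For admissible parameters `γ > 0` ((3.2): `γ ≥ δ/8 > 0`). [cite: BCCDS2024, (3.2) p. 5] -/
theorem ParamsAdmissible.gammaOf_pos {α β ε δ a₀ : ℝ} (h : ParamsAdmissible α β ε δ a₀) :
    0 < gammaOf β ε δ := by
  unfold gammaOf
  obtain ⟨hδ0, hδ1⟩ := h.hδ
  obtain ⟨hε0, -⟩ := h.hε
  obtain ⟨hβ0, -⟩ := h.hβ
  have hA : 0 ≤ 3 * β * (1 + 3 * ε * (1 + δ)) * (1 + δ) := by positivity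
  have hB : 0 ≤ 3 * β * (1 + 3 * ε * (1 + δ)) * (1 + δ) / (1 - δ) := div_nonneg hA (by linarith)
  linarith

/-! ## §3.2 Temporal support, time slots, derivative norms -/

/-- The temporal support `supp_T(f) = closure {t ∈ [0,2] : ∃ x, f(t,x) ≠ 0}` of a planar field on
`[0,2] × T²` (§3.2 p. 6). [cite: BCCDS2024, §3.2 p. 6] -/
def temporalSupport (f : ℝ → UnitAddTorus (Fin 2) → EuclideanSpace ℝ (Fin 2)) : Set ℝ :=
  closure {t ∈ Icc (0 : ℝ) 2 | ∃ x, f t x ≠ 0}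

/-- The time slot `I_q = [1 - T_q, 1 - T_{q+1}]` before the singular time, `q ∈ ℕ` (§3.2 p. 6;
`I_{-1} = [0, 1 - T_0]` since `T_{-1} = 1`). [cite: BCCDS2024, §3.2 p. 6] -/
def slotI (T : ℕ → ℝ) (q : ℕ) : Set ℝ :=
  Icc (1 - T q) (1 - T (q + 1))

/-- The reflected time slot `J_q = [1 + T_{q+1}, 1 + T_q]` after the singular time, `q ∈ ℕ` (§3.2 p. 6;
`J_{-1} = [1 + T_0, 2]`). [cite: BCCDS2024, §3.2 p. 6] -/
def slotJ (T : ℕ → ℝ) (q : ℕ) : Set ℝ :=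
  Icc (1 + T (q + 1)) (1 + T q)

/-- The mixed derivative sup-norm `‖∂ₜ^ℓ ∇^k u‖_{L^∞(S × T²)}` of a planar space–time field ((3.7) p. 6):
the supremum over `t ∈ S` and `y ∈ ℝ²` of the norm of the `k`-th spatial Fréchet derivative at `y` of
`y ↦ ∂ₜ^ℓ u(t, π y)`, `π : ℝ² → T²` the covering map (the lift is `1`-periodic, so the supremum over `ℝ²`
is that over a fundamental domain). [cite: BCCDS2024, (3.7) p. 6] -/
def mixedDerivSup (S : Set ℝ) (k ℓ : ℕ) (u : ℝ → UnitAddTorus (Fin 2) → EuclideanSpace ℝ (Fin 2)) : ℝ≥0∞ :=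
  ⨆ t ∈ S, ⨆ y : EuclideanSpace ℝ (Fin 2),
    ‖iteratedFDeriv ℝ k
        (fun y' : EuclideanSpace ℝ (Fin 2) =>
          iteratedDeriv ℓ (fun s : ℝ => u s (FunctionSpaces.Torus.proj y')) t) y‖ₑ

end BCCDS2024

/-! ## Proposition 3.1 -/

/-- **Bruè–Colombo–Crippa–De Lellis–Sorella, Proposition 3.1** (arXiv:2212.08413v1, p. 6; "The results
below are taken from [CCS22]"), verbatim: "Let `α, β, γ, ε, δ`, and `{a_q}_{q∈ℕ}` as above [§3.1,
(3.1)–(3.4)]. Then there exist a decreasing sequence of times `{T_q}_{q∈ℕ∪{-1}}` satisfying `T_{-1} = 1` and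
`T_q ↓ 0` as `q → ∞`, an initial datum `ϑ_in ∈ C^∞(T²)` with `∫_{T²} ϑ_in = 0`, and a divergence-free
velocity field `u ∈ C^∞_loc(((0,2) ∖ {1}) × T²; ℝ²)`, such that the following hold:
(1) (Reflection and shear flow) For any `t ∈ (0,2)`, `u(t,·)` coincides either with an horizontal shear
flow, or with a vertical one. Moreover `u(t,x) = -u(2-t,x)` for any `t ∈ (1,2)` and `x ∈ T²`.
(2) (Time intervals) For any `q ∈ ℕ` we have `|T_q - T_{q+1}| ≤ 4a_q^{γ-γδ}`, and
`supp_T(u) ∩ (I_{-1} ∪ J_{-1}) = ∅` (3.5), `|supp_T(u) ∩ (I_q ∪ J_q)| ≤ 6a_q^γ` (3.6). Moreover,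
`u(t,·) ≡ 0` for any `t` in a neighborhood of `1 - T_q` and `1 + T_q`.
(3) (Regularity of the velocity field) For any `k ∈ ℕ` and `ℓ ∈ ℕ` there exists a constant `C > 0` such
that `‖∂ₜ^ℓ ∇^k u‖_{L^∞((I_q ∪ J_q) × T²)} ≤ C a_q^{1-γ} a_{q+1}^{-k(1+εδ)} a_q^{-ℓγ}` (3.7), for any `q ∈ ℕ`.
(4) (Regularity of the solution) For any `ν > 0` there exists a unique bounded solution
`ϑ_ν : [0,2] × T² → ℝ` of the advection-diffusion equation `∂ₜϑ_ν + u·∇ϑ_ν = νΔϑ_ν` (3.8) with initial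
datum `ϑ_in`. For `ν = 0`, the advection equation with velocity field `u` and initial datum `ϑ_in` has a
unique bounded solution with the symmetry `ϑ₀(t,x) = ϑ₀(2-t,x)` for any `t ∈ (1,2)` and `x ∈ T²`. The
family of solutions `{ϑ_ν}_{ν∈[0,1]}` satisfies
`sup_{ν∈[0,1]} ‖∇ϑ_ν‖_{L^∞(I_q × T²)} ≤ ‖∇ϑ_in‖_{L^∞} a_{q+1}^{-1-3ε(1+δ)}`, for any `q ∈ ℕ`.
(5) (Anomalous dissipation) For any `q ∈ ℕ` we set `ν̃_q = a_q^{2 - γ/(1+δ) + 4ε}` (3.9). There exists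
`m ∈ ℕ` such that the sequence `{ϑ_{ν̃_q}}_{q∈ℕ}` satisfies
`2ν̃_q ∫₀^{1-T_q+t̄_q} ∫_{T²} |∇ϑ_{ν̃_q}|² dx dt > 1/2` for any `q ∈ mℕ` (3.10), where `t̄_q ∈ (T_{q+1}, T_q)`
is a suitable intermediate time such that `supp_T(u) ∩ (1-T_q, 1-T_q+t̄_q) = ∅`."
Proof as printed: from Colombo–Crippa–Sorella 2023, §4 with `1/p = 1/p° = 1/3` ((1), (2)), Rem. 4.2 ((3)),
§8 ((4)), §7 and Thm. A ((5)) — cf. `ColomboCrippaSorella2023_thmA`. Rendering: see the module docstring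
(`BCCDS2024.ParamsAdmissible`, `aSeq`, `gammaOf`, `viscSeq`, `temporalSupport`, `slotI/J`, `mixedDerivSup`;
weak solutions `Torus.IsWeakScalarTransportOn 2 ν u ϑ_in` on `T² × [0,2)`, uniqueness among bounded ones,
pointwise properties on the bounded representative). [cite: BCCDS2024, Prop. 3.1 p. 6, (3.5)–(3.10); ColomboCrippaSorella2023, §4 Rem. 4.2, §§7–8] -/
def BCCDS2024_prop31 : Prop :=
  ∀ (α β ε δ a₀ : ℝ), BCCDS2024.ParamsAdmissible α β ε δ a₀ →
    ∃ (T : ℕ → ℝ) (θin : UnitAddTorus (Fin 2) → ℝ)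
      (u : ℝ → UnitAddTorus (Fin 2) → EuclideanSpace ℝ (Fin 2)),
      -- the times: decreasing, non-negative, `T_{-1} = 1 ≥ T_0`, `T_q ↓ 0`
      Antitone T ∧ (∀ q, 0 ≤ T q) ∧ T 0 ≤ 1 ∧ Tendsto T atTop (𝓝 0) ∧
      -- the datum: smooth, mean zero
      FunctionSpaces.Torus.IsSmooth θin ∧ FunctionSpaces.Torus.HasZeroMean θin ∧
      -- the field: smooth away from `t = 1`, divergence free
      FunctionSpaces.Torus.IsSmoothSpaceTimeOn (Ioo (0 : ℝ) 2 \ {1}) u ∧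
      (∀ t ∈ Ioo (0 : ℝ) 2 \ {1}, FunctionSpaces.Torus.IsDivFree (u t)) ∧
      -- (1) reflection and shear flow
      (∀ t ∈ Ioo (0 : ℝ) 2,
        (∃ W : UnitAddCircle → ℝ, ∀ x, u t x = WithLp.toLp 2 ![W (x 1), 0]) ∨
          (∃ W : UnitAddCircle → ℝ, ∀ x, u t x = WithLp.toLp 2 ![0, W (x 0)])) ∧
      (∀ t ∈ Ioo (1 : ℝ) 2, ∀ x, u t x = -u (2 - t) x) ∧
      -- (2) time intervals, (3.5), (3.6), and vanishing near `1 ∓ T_q`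
      (∀ q : ℕ, |T q - T (q + 1)| ≤
        4 * BCCDS2024.aSeq a₀ δ q ^ (BCCDS2024.gammaOf β ε δ - BCCDS2024.gammaOf β ε δ * δ)) ∧
      BCCDS2024.temporalSupport u ∩ (Icc (0 : ℝ) (1 - T 0) ∪ Icc (1 + T 0) 2) = ∅ ∧
      (∀ q : ℕ, volume.real (BCCDS2024.temporalSupport u ∩ (BCCDS2024.slotI T q ∪ BCCDS2024.slotJ T q)) ≤
        6 * BCCDS2024.aSeq a₀ δ q ^ BCCDS2024.gammaOf β ε δ) ∧
      (∀ q : ℕ, (∀ᶠ t in 𝓝 (1 - T q), u t = 0) ∧ ∀ᶠ t in 𝓝 (1 + T q), u t = 0) ∧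
      -- (3) regularity of the field, (3.7)
      (∀ k ℓ : ℕ, ∃ C : ℝ, 0 < C ∧ ∀ q : ℕ,
        BCCDS2024.mixedDerivSup (BCCDS2024.slotI T q ∪ BCCDS2024.slotJ T q) k ℓ u ≤
          ENNReal.ofReal (C * BCCDS2024.aSeq a₀ δ q ^ (1 - BCCDS2024.gammaOf β ε δ) *
            BCCDS2024.aSeq a₀ δ (q + 1) ^ (-((k : ℝ) * (1 + ε * δ))) *
            BCCDS2024.aSeq a₀ δ q ^ (-((ℓ : ℝ) * BCCDS2024.gammaOf β ε δ)))) ∧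
      -- (4) uniqueness on `T² × [0,2)`: for `ν > 0` among bounded weak solutions; for `ν = 0` among bounded
      -- weak solutions WITH the reflection symmetry `ϑ(t,x) = ϑ(2-t,x)`, `t ∈ (1,2)` (as printed: "a unique
      -- bounded solution with the symmetry" — across the singular time bounded transport solutions are NOT
      -- unique, cf. Theorem B of the source and `ColomboCrippaSorella2023_thmB`) …
      (∀ ν : ℝ, 0 ≤ ν → ∀ θ₁ θ₂ : ℝ → UnitAddTorus (Fin 2) → ℝ,
        Torus.IsWeakScalarTransportOn 2 ν u θin θ₁ → Torus.IsWeakScalarTransportOn 2 ν u θin θ₂ →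
        (∃ M : ℝ, ∀ᵐ t ∂(volume.restrict (Ioo (0 : ℝ) 2)), ∀ᵐ x ∂volume, |θ₁ t x| ≤ M) →
        (∃ M : ℝ, ∀ᵐ t ∂(volume.restrict (Ioo (0 : ℝ) 2)), ∀ᵐ x ∂volume, |θ₂ t x| ≤ M) →
        (ν = 0 → ∀ t ∈ Ioo (1 : ℝ) 2, ∀ x, θ₁ t x = θ₁ (2 - t) x) →
        (ν = 0 → ∀ t ∈ Ioo (1 : ℝ) 2, ∀ x, θ₂ t x = θ₂ (2 - t) x) →
          ∀ᵐ t ∂(volume.restrict (Ioo (0 : ℝ) 2)), θ₁ t =ᵐ[volume] θ₂ t) ∧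
      -- … and existence of a bounded solution, with the symmetry for `ν = 0` and, for `ν ∈ [0,1]`, the
      -- gradient bound `‖∇ϑ_ν‖_{L^∞(I_q × T²)} ≤ ‖∇ϑ_in‖_{L^∞} a_{q+1}^{-1-3ε(1+δ)}` on every `I_q`
      (∀ ν : ℝ, 0 ≤ ν → ∃ θ : ℝ → UnitAddTorus (Fin 2) → ℝ,
        Torus.IsWeakScalarTransportOn 2 ν u θin θ ∧
        (∃ M : ℝ, ∀ t ∈ Ico (0 : ℝ) 2, ∀ x, |θ t x| ≤ M) ∧
        (ν = 0 → ∀ t ∈ Ioo (1 : ℝ) 2, ∀ x, θ t x = θ (2 - t) x) ∧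
        (ν ≤ 1 → ∀ q : ℕ, ∀ t ∈ BCCDS2024.slotI T q,
          FunctionSpaces.Torus.IsSmooth (θ t) ∧
          ∀ x, ‖FunctionSpaces.Torus.gradient (θ t) x‖ ≤
            (⨆ y, ‖FunctionSpaces.Torus.gradient θin y‖) *
              BCCDS2024.aSeq a₀ δ (q + 1) ^ (-(1 + 3 * ε * (1 + δ))))) ∧
      -- (5) anomalous dissipation `> 1/2` along `ν̃_q`, `q ∈ mℕ`, (3.9)–(3.10)
      (∃ m : ℕ, 0 < m ∧ ∀ q : ℕ, m ∣ q → ∃ tbar : ℝ, tbar ∈ Ioo (T (q + 1)) (T q) ∧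
        BCCDS2024.temporalSupport u ∩ Ioo (1 - T q) (1 - T q + tbar) = ∅ ∧
        ∀ θ : ℝ → UnitAddTorus (Fin 2) → ℝ,
          Torus.IsWeakScalarTransportOn 2 (BCCDS2024.viscSeq a₀ δ (BCCDS2024.gammaOf β ε δ) ε q) u θin θ →
          (∃ M : ℝ, ∀ᵐ t ∂(volume.restrict (Ioo (0 : ℝ) 2)), ∀ᵐ x ∂volume, |θ t x| ≤ M) →
            (1 / 2 : ℝ≥0∞) <
              2 * Torus.eScalarDissipation (BCCDS2024.viscSeq a₀ δ (BCCDS2024.gammaOf β ε δ) ε q) θ 0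
                (1 - T q + tbar))

/-! ## Proved consequences -/

/-- **The block dissipates anomalously along `ν̃_q → 0`, on the unit time window** (bookkeeping from
`BCCDS2024_prop31`): for admissible parameters there are the block `(T, ϑ_in, u)` and `m ≥ 1` such that
for every `q ∈ mℕ` every bounded weak solution with diffusivity `ν̃_q` has
`ν̃_q ∫₀¹ ‖∇ϑ‖²_{L²} > 1/4`, i.e. `1 < 4 ν̃_q ∫₀¹ ‖∇ϑ‖²` (from (3.10) by monotonicity of the cumulative
dissipation in the upper limit, `1 - T_q + t̄_q ≤ 1`) — the dissipation on `[0,1]` that §5 (5.2) transfers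
to the Navier–Stokes solutions. [cite: BCCDS2024, Prop. 3.1 (5) p. 6, (3.10)] -/
theorem BCCDS2024_prop31.one_lt_four_mul_dissipation (h : BCCDS2024_prop31) {α β ε δ a₀ : ℝ}
    (hP : BCCDS2024.ParamsAdmissible α β ε δ a₀) :
    ∃ (T : ℕ → ℝ) (θin : UnitAddTorus (Fin 2) → ℝ)
      (u : ℝ → UnitAddTorus (Fin 2) → EuclideanSpace ℝ (Fin 2)) (m : ℕ), 0 < m ∧
      FunctionSpaces.Torus.IsSmooth θin ∧ FunctionSpaces.Torus.HasZeroMean θin ∧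
      Tendsto T atTop (𝓝 0) ∧
      ∀ q : ℕ, m ∣ q → ∀ θ : ℝ → UnitAddTorus (Fin 2) → ℝ,
        Torus.IsWeakScalarTransportOn 2 (BCCDS2024.viscSeq a₀ δ (BCCDS2024.gammaOf β ε δ) ε q) u θin θ →
        (∃ M : ℝ, ∀ᵐ t ∂(volume.restrict (Ioo (0 : ℝ) 2)), ∀ᵐ x ∂volume, |θ t x| ≤ M) →
          1 < 4 * Torus.eScalarDissipation (BCCDS2024.viscSeq a₀ δ (BCCDS2024.gammaOf β ε δ) ε q) θ 0 1 := by
  obtain ⟨T, θin, u, -, -, -, hlim, hsm, hmean, -, -, -, -, -, -, -, -, -, -, -, hAD⟩ :=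
    h α β ε δ a₀ hP
  obtain ⟨m, hm, hq⟩ := hAD
  refine ⟨T, θin, u, m, hm, hsm, hmean, hlim, fun q hmq θ hθ hbd => ?_⟩
  obtain ⟨tbar, htbar, -, hdiss⟩ := hq q hmq
  set ν := BCCDS2024.viscSeq a₀ δ (BCCDS2024.gammaOf β ε δ) ε q with hν
  have h1 : (1 / 2 : ℝ≥0∞) < 2 * Torus.eScalarDissipation ν θ 0 (1 - T q + tbar) := hdiss θ hθ hbd
  -- monotonicity of the cumulative dissipation in the upper limit: `1 - T q + tbar ≤ 1`
  have hle : Torus.eScalarDissipation ν θ 0 (1 - T q + tbar) ≤ Torus.eScalarDissipation ν θ 0 1 := by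
    unfold Torus.eScalarDissipation
    exact mul_le_mul' le_rfl (lintegral_mono_set (Ioo_subset_Ioo le_rfl (by linarith [htbar.2])))
  have h2 : (1 / 2 : ℝ≥0∞) < 2 * Torus.eScalarDissipation ν θ 0 1 :=
    h1.trans_le (mul_le_mul' le_rfl hle)
  have h3 : (1 / 2 : ℝ≥0∞) * 2 < 2 * Torus.eScalarDissipation ν θ 0 1 * 2 :=
    ENNReal.mul_left_strictMono two_ne_zero ENNReal.ofNat_ne_top h2
  have h4 : (1 / 2 : ℝ≥0∞) * 2 = 1 := by
    rw [one_div, ENNReal.inv_mul_cancel two_ne_zero ENNReal.ofNat_ne_top]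
  calc (1 : ℝ≥0∞) = 1 / 2 * 2 := h4.symm
    _ < 2 * Torus.eScalarDissipation ν θ 0 1 * 2 := h3
    _ = 4 * Torus.eScalarDissipation ν θ 0 1 := by ring

/-! ## The diffusivities `ν̃_q` vanish, and the block dissipates along them (appended 2026-08-26) -/

/-- The scales `a_q = a₀^{(1+δ)^q}` tend to `0` super-exponentially for `a₀ ∈ (0,1)`, `δ > 0` (squeeze with
Bernoulli: `(1+δ)^q ≥ 1 + qδ`, so `0 < a_q ≤ a₀ (a₀^δ)^q → 0`). [cite: BCCDS2024, (3.4) p. 6] -/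
theorem BCCDS2024.tendsto_aSeq_zero {a₀ δ : ℝ} (ha₀ : 0 < a₀) (ha₁ : a₀ < 1) (hδ : 0 < δ) :
    Tendsto (BCCDS2024.aSeq a₀ δ) atTop (𝓝 0) := by
  -- the geometric majorant `a₀ · (a₀^δ)^q`
  have hr0 : 0 ≤ a₀ ^ δ := (Real.rpow_pos_of_pos ha₀ δ).le
  have hr1 : a₀ ^ δ < 1 := Real.rpow_lt_one ha₀.le ha₁ hδ
  have hgeom : Tendsto (fun q : ℕ => a₀ * (a₀ ^ δ) ^ q) atTop (𝓝 0) := by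
    simpa using (tendsto_pow_atTop_nhds_zero_of_lt_one hr0 hr1).const_mul a₀
  refine tendsto_of_tendsto_of_tendsto_of_le_of_le tendsto_const_nhds hgeom
    (fun q => (BCCDS2024.aSeq_pos ha₀ δ q).le) (fun q => ?_)
  -- `a₀^{(1+δ)^q} ≤ a₀^{1 + qδ} = a₀ (a₀^δ)^q`
  have hB : 1 + (q : ℝ) * δ ≤ (1 + δ) ^ q := one_add_mul_le_pow (by linarith) q
  calc BCCDS2024.aSeq a₀ δ q = a₀ ^ ((1 + δ) ^ q) := rfl
    _ ≤ a₀ ^ (1 + (q : ℝ) * δ) := Real.rpow_le_rpow_of_exponent_ge ha₀ ha₁.le hB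
    _ = a₀ * (a₀ ^ δ) ^ q := by
        rw [Real.rpow_add ha₀, Real.rpow_one, mul_comm (q : ℝ) δ, Real.rpow_mul ha₀.le,
          Real.rpow_natCast]

/-- The diffusivities are positive: `ν̃_q > 0`. [cite: BCCDS2024, (3.9) p. 6] -/
theorem BCCDS2024.viscSeq_pos {a₀ : ℝ} (ha₀ : 0 < a₀) (δ γ ε : ℝ) (q : ℕ) :
    0 < BCCDS2024.viscSeq a₀ δ γ ε q :=
  Real.rpow_pos_of_pos (BCCDS2024.aSeq_pos ha₀ δ q) _

/-- For admissible parameters the diffusivities `ν̃_q = a_q^{2 - γ/(1+δ) + 4ε}` tend to `0` (the exponent is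
`> 1`, since `γ < 1 < 1 + δ` and `ε > 0`). [cite: BCCDS2024, (3.9) p. 6] -/
theorem BCCDS2024.ParamsAdmissible.tendsto_viscSeq_zero {α β ε δ a₀ : ℝ}
    (h : BCCDS2024.ParamsAdmissible α β ε δ a₀) :
    Tendsto (BCCDS2024.viscSeq a₀ δ (BCCDS2024.gammaOf β ε δ) ε) atTop (𝓝 0) := by
  have hγ := h.gammaOf_lt_one
  have hγ0 := h.gammaOf_pos
  obtain ⟨hδ0, -⟩ := h.hδ
  obtain ⟨hε0, -⟩ := h.hε
  obtain ⟨ha₀, ha₁⟩ := h.ha₀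
  have hquot : BCCDS2024.gammaOf β ε δ / (1 + δ) < 1 := by
    rw [div_lt_one (by linarith)]
    linarith
  have hexp : 0 < 2 - BCCDS2024.gammaOf β ε δ / (1 + δ) + 4 * ε := by linarith
  exact (BCCDS2024.tendsto_aSeq_zero ha₀ ha₁ hδ0).rpow_const_nhds_zero hexp

/-- **Scalar anomalous dissipation along an explicit vanishing sequence of diffusivities** (consequence of
`BCCDS2024_prop31`, items (4)–(5)): for admissible parameters there are the datum and field `(ϑ_in, u)` and
diffusivities `κ_j = ν̃_{m j} > 0`, `κ_j → 0`, such that for every `j` every bounded weak solution of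
`∂ₜϑ + u·∇ϑ = κ_jΔϑ`, `ϑ(0) = ϑ_in` on `T² × [0,2)` dissipates on the unit window: `1 < 4 κ_j ∫₀¹ ‖∇ϑ‖²_{L²}`
(a `j`-uniform floor; with (4) — existence of the bounded solution — this is anomalous dissipation in the
`liminf` sense along `κ_j`, the form of the sequence statements of `TurbPassiveScalar.lean`).
[cite: BCCDS2024, Prop. 3.1 (4)–(5) p. 6, (3.9)–(3.10)] -/
theorem BCCDS2024_prop31.exists_dissipating_sequence (h : BCCDS2024_prop31) {α β ε δ a₀ : ℝ}
    (hP : BCCDS2024.ParamsAdmissible α β ε δ a₀) :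
    ∃ (θin : UnitAddTorus (Fin 2) → ℝ)
      (u : ℝ → UnitAddTorus (Fin 2) → EuclideanSpace ℝ (Fin 2)) (κ : ℕ → ℝ),
      FunctionSpaces.Torus.IsSmooth θin ∧ FunctionSpaces.Torus.HasZeroMean θin ∧
      (∀ j, 0 < κ j) ∧ Tendsto κ atTop (𝓝 0) ∧
      (∀ j, ∃ θ : ℝ → UnitAddTorus (Fin 2) → ℝ,
        Torus.IsWeakScalarTransportOn 2 (κ j) u θin θ ∧ ∃ M : ℝ, ∀ t ∈ Ico (0 : ℝ) 2, ∀ x, |θ t x| ≤ M) ∧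
      ∀ j, ∀ θ : ℝ → UnitAddTorus (Fin 2) → ℝ,
        Torus.IsWeakScalarTransportOn 2 (κ j) u θin θ →
        (∃ M : ℝ, ∀ᵐ t ∂(volume.restrict (Ioo (0 : ℝ) 2)), ∀ᵐ x ∂volume, |θ t x| ≤ M) →
          1 < 4 * Torus.eScalarDissipation (κ j) θ 0 1 := by
  -- items (4) (existence of bounded solutions, every `ν ≥ 0`) and (5) (the floor along `ν̃_q`, `q ∈ m'ℕ`)
  obtain ⟨T', θin', u', -, -, -, -, hsm', hmean', -, -, -, -, -, -, -, -, -, -, hex', hAD'⟩ := h α β ε δ a₀ hP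
  obtain ⟨m', hm', hq'⟩ := hAD'
  obtain ⟨ha₀, -⟩ := hP.ha₀
  refine ⟨θin', u', fun j => BCCDS2024.viscSeq a₀ δ (BCCDS2024.gammaOf β ε δ) ε (m' * j), hsm', hmean',
    fun j => BCCDS2024.viscSeq_pos ha₀ _ _ _ _, ?_, fun j => ?_, fun j θ hθ hbd => ?_⟩
  · -- `κ_j → 0`: `ν̃_q → 0` and `m' j → ∞`
    have hmul : Tendsto (fun j : ℕ => m' * j) atTop atTop :=
      tendsto_atTop_mono (fun j => Nat.le_mul_of_pos_left j hm') tendsto_id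
    exact hP.tendsto_viscSeq_zero.comp hmul
  · obtain ⟨θ, hθ, hM, -, -⟩ := hex' _ (BCCDS2024.viscSeq_pos ha₀ _ _ _ _).le
    exact ⟨θ, hθ, hM⟩
  · -- the floor at `q = m' j ∈ m'ℕ`, transported to the unit window as in `one_lt_four_mul_dissipation`
    obtain ⟨tbar, htbar, -, hdiss⟩ := hq' (m' * j) (Dvd.intro j rfl)
    set ν := BCCDS2024.viscSeq a₀ δ (BCCDS2024.gammaOf β ε δ) ε (m' * j) with hν
    have h1 : (1 / 2 : ℝ≥0∞) < 2 * Torus.eScalarDissipation ν θ 0 (1 - T' (m' * j) + tbar) := hdiss θ hθ hbd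
    have hle : Torus.eScalarDissipation ν θ 0 (1 - T' (m' * j) + tbar) ≤ Torus.eScalarDissipation ν θ 0 1 := by
      unfold Torus.eScalarDissipation
      exact mul_le_mul' le_rfl (lintegral_mono_set (Ioo_subset_Ioo le_rfl (by linarith [htbar.2])))
    have h2 : (1 / 2 : ℝ≥0∞) < 2 * Torus.eScalarDissipation ν θ 0 1 :=
      h1.trans_le (mul_le_mul' le_rfl hle)
    have h3 : (1 / 2 : ℝ≥0∞) * 2 < 2 * Torus.eScalarDissipation ν θ 0 1 * 2 :=
      ENNReal.mul_left_strictMono two_ne_zero ENNReal.ofNat_ne_top h2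
    have h4 : (1 / 2 : ℝ≥0∞) * 2 = 1 := by
      rw [one_div, ENNReal.inv_mul_cancel two_ne_zero ENNReal.ofNat_ne_top]
    calc (1 : ℝ≥0∞) = 1 / 2 * 2 := h4.symm
      _ < 2 * Torus.eScalarDissipation ν θ 0 1 * 2 := h3
      _ = 4 * Torus.eScalarDissipation ν θ 0 1 := by ring

end Literature.Analysis.FluidPDE

end
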